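import Mathlib
import Summits.PneNP.PneNP.Theorems.Nc03AvoidResidualCoreReductionEasy
import Summits.PneNP.PneNP.Theorems.Nc03AvoidResidualCoreReductionFlip

/-!
# Route Nc03AvoidResidualCore, item `ResidualCoreReduction` — the `MAJ₃` class: rigidity

Helper file for `stmt-PneNP-20227` (residual-core reduction of `NC⁰₃-AVOID` at linear stretch; cell
pnp-ideate). For a PURE `MAJ₃` instance (`rep 6`; by symmetry we call roles `0, 1` the junction roles
and role `2` the label role) we prove the SOUNDNESS of the rigidity certificate:

* `maj_rigid`: let `E` be a set of outputs and `y` a pattern that is EXACTLY BALANCED on `E` at the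
  two junction roles (at every variable `v`, among the outputs of `E` reading `v` in role `0` as many
  show `1` as `0`, and likewise in role `1`). If some variable labels (role `2`) an output of `E`
  showing `1` and another showing `0`, then `y` is not attained. Proof: for an assignment `x` let
  `s_j` be the number of true inputs of output `j`; `MAJ` gives `s_j ≥ 2` on `1`-outputs and
  `s_j ≤ 1` on `0`-outputs, so `Σ_E ± s_j ≥ 2m₁ - m₀ = m₁`; expanding `s_j` by roles, the junction
  roles contribute `0` by balance and the label role at most `Σ_c #{1-outputs labelled c} - 1 =
  m₁ - 1`, the `-1` coming from the bichromatic label. Contradiction.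

This replaces the cycle/2-SAT analysis of Kuntewar–Sarma for `MAJ₃` by a counting argument in the
style of the `MUX` rigidity (`…ReductionMuxA`); existence of balanced bichromatic patterns at linear
stretch follows from the one-flip lemma (`…ReductionFlip`) in the sequel. [folklore]
-/

set_option linter.dupNamespace false -- `Summit.PneNP.PneNP.…`: summit = sub-problem name (D-0017 single-conjunct layout)

namespace Summit.PneNP.PneNP.Theorems.Nc03Reduction

open Finset Literature.Computability.Complexity

variable {N M : ℕ}

/-- `MAJ₃ = 1` needs at least two true inputs. -/
theorem maj_true_count (a b c : Bool) (h : ((a && b) || (a && c) || (b && c)) = true) :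
    (2 : ℤ) ≤ (if a = true then 1 else 0) + (if b = true then 1 else 0) + (if c = true then 1 else 0) := by
  revert a b c h; decide

/-- `MAJ₃ = 0` allows at most one true input. -/
theorem maj_false_count (a b c : Bool) (h : ((a && b) || (a && c) || (b && c)) = false) :
    (if a = true then 1 else 0) + (if b = true then 1 else 0) + (if c = true then 1 else 0) ≤ (1 : ℤ) := by
  revert a b c h; decide

/-- A signed fibre sum: over the outputs of `E` reading `v` in role `r`, the signs `±1` of the
pattern add up to `#1 - #0`. -/
theorem sum_sign_fiber (I : LocalMap 3 N M) (E : Finset (Fin M)) (y : Fin M → Bool) (r : Fin 3)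
    (v : Fin N) :
    ∑ j ∈ E.filter (fun j => I.vars j r = v), (if y j = true then (1 : ℤ) else -1) =
      ((E.filter fun j => I.vars j r = v ∧ y j = true).card : ℤ) -
        ((E.filter fun j => I.vars j r = v ∧ y j = false).card : ℤ) := by
  classical
  have e1 : ∀ j, (if y j = true then (1 : ℤ) else -1) =
      (if y j = true then 1 else 0) - (if y j = false then 1 else 0) := by
    intro j; cases y j <;> simp
  simp_rw [e1]
  rw [Finset.sum_sub_distrib, Finset.sum_boole, Finset.sum_boole, Finset.filter_filter,
    Finset.filter_filter]

/-- Fibrewise count: summing over the variable read in role `r`. -/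
theorem sum_card_fiber (I : LocalMap 3 N M) (E : Finset (Fin M)) (y : Fin M → Bool) (r : Fin 3)
    (c : Bool) :
    ∑ v : Fin N, ((E.filter fun j => I.vars j r = v ∧ y j = c).card : ℤ) =
      ((E.filter fun j => y j = c).card : ℤ) := by
  classical
  have h := Finset.card_eq_sum_card_fiberwise (s := E.filter fun j => y j = c) (t := Finset.univ)
    (f := fun j => I.vars j r) (fun _ _ => Finset.mem_coe.2 (Finset.mem_univ _))
  rw [h]
  push_cast
  refine Finset.sum_congr rfl fun v _ => ?_
  have e : (E.filter fun j => I.vars j r = v ∧ y j = c) =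
      (E.filter fun j => y j = c).filter (fun j => I.vars j r = v) := by
    ext j; simp only [Finset.mem_filter]; tauto
  rw [e]

/-- **`MAJ₃` rigidity.** A pattern exactly balanced at the two junction roles on a set of outputs
`E`, with a label variable occurring in `E` on outputs of both colours, is not attained. -/
theorem maj_rigid {I : LocalMap 3 N M} (hP : I.IsPure (rep 6)) (E : Finset (Fin M))
    {y : Fin M → Bool}
    (h0 : ∀ v, (E.filter fun j => I.vars j 0 = v ∧ y j = true).card =
      (E.filter fun j => I.vars j 0 = v ∧ y j = false).card)
    (h1 : ∀ v, (E.filter fun j => I.vars j 1 = v ∧ y j = true).card =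
      (E.filter fun j => I.vars j 1 = v ∧ y j = false).card)
    {j₁ j₂ : Fin M} (hj₁ : j₁ ∈ E) (hj₂ : j₂ ∈ E) (hlab : I.vars j₁ 2 = I.vars j₂ 2)
    (hy₁ : y j₁ = true) (hy₂ : y j₂ = false) : y ∉ I.range := by
  classical
  rintro ⟨x, hx⟩
  have hev : ∀ j, y j = ((x (I.vars j 0) && x (I.vars j 1)) || (x (I.vars j 0) && x (I.vars j 2)) ||
      (x (I.vars j 1) && x (I.vars j 2))) := by
    intro j; rw [← hx, eval_of_isPure hP]; rfl
  -- notation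
  set bx : Fin N → ℤ := fun v => if x v = true then 1 else 0 with hbx
  set sg : Fin M → ℤ := fun j => if y j = true then 1 else -1 with hsg
  set m₁ : ℤ := ((E.filter fun j => y j = true).card : ℤ) with hm₁
  set m₀ : ℤ := ((E.filter fun j => y j = false).card : ℤ) with hm₀
  -- balance gives `m₁ = m₀`
  have hm : m₁ = m₀ := by
    rw [hm₁, hm₀, ← sum_card_fiber I E y 0 true, ← sum_card_fiber I E y 0 false]
    exact Finset.sum_congr rfl fun v _ => by exact_mod_cast h0 v
  have hE : (E.card : ℤ) = m₁ + m₀ := by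
    have h := Finset.card_filter_add_card_filter_not (s := E) (fun j => y j = true)
    have e2 : (E.filter fun j => ¬ y j = true) = E.filter fun j => y j = false := by
      ext j; simp
    rw [e2] at h
    rw [hm₁, hm₀]; exact_mod_cast h.symm
  -- the signed input count
  set S : ℤ := ∑ j ∈ E, sg j * (bx (I.vars j 0) + bx (I.vars j 1) + bx (I.vars j 2)) with hS
  -- lower bound from `MAJ`
  have hlow : m₁ ≤ S := by
    have hpt : ∀ j ∈ E, 3 * (if y j = true then (1 : ℤ) else 0) - 1 ≤
        sg j * (bx (I.vars j 0) + bx (I.vars j 1) + bx (I.vars j 2)) := by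
      intro j _
      have hj := hev j
      simp only [hsg, hbx]
      cases hyj : y j
      · rw [hyj] at hj
        have := maj_false_count _ _ _ hj.symm
        simp only [Bool.false_eq_true, if_false]
        linarith
      · rw [hyj] at hj
        have := maj_true_count _ _ _ hj.symm
        simp only [if_true]
        linarith
    have hsum := Finset.sum_le_sum hpt
    rw [← hS, Finset.sum_sub_distrib, ← Finset.mul_sum, Finset.sum_boole, Finset.sum_const,
      nsmul_eq_mul, mul_one] at hsum
    rw [← hm₁, hE] at hsum
    linarith
  -- expansion by roles
  have hT : ∀ r : Fin 3, ∑ j ∈ E, sg j * bx (I.vars j r) =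
      ∑ v : Fin N, bx v * (((E.filter fun j => I.vars j r = v ∧ y j = true).card : ℤ) -
        ((E.filter fun j => I.vars j r = v ∧ y j = false).card : ℤ)) := by
    intro r
    rw [← Finset.sum_fiberwise_of_maps_to (s := E) (t := Finset.univ) (g := fun j => I.vars j r)
      (fun _ _ => Finset.mem_univ _)]
    refine Finset.sum_congr rfl fun v _ => ?_
    rw [← sum_sign_fiber I E y r v, Finset.mul_sum]
    refine Finset.sum_congr rfl fun j hj => ?_
    rw [(Finset.mem_filter.1 hj).2, mul_comm]
  have hS' : S = ∑ j ∈ E, sg j * bx (I.vars j 0) + ∑ j ∈ E, sg j * bx (I.vars j 1) +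
      ∑ j ∈ E, sg j * bx (I.vars j 2) := by
    rw [hS, ← Finset.sum_add_distrib, ← Finset.sum_add_distrib]
    refine Finset.sum_congr rfl fun j _ => by ring
  have hT0 : ∑ j ∈ E, sg j * bx (I.vars j 0) = 0 := by
    rw [hT 0]
    refine Finset.sum_eq_zero fun v _ => ?_
    rw [show ((E.filter fun j => I.vars j 0 = v ∧ y j = true).card : ℤ) =
      ((E.filter fun j => I.vars j 0 = v ∧ y j = false).card : ℤ) from by exact_mod_cast h0 v]
    ring
  have hT1 : ∑ j ∈ E, sg j * bx (I.vars j 1) = 0 := by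
    rw [hT 1]
    refine Finset.sum_eq_zero fun v _ => ?_
    rw [show ((E.filter fun j => I.vars j 1 = v ∧ y j = true).card : ℤ) =
      ((E.filter fun j => I.vars j 1 = v ∧ y j = false).card : ℤ) from by exact_mod_cast h1 v]
    ring
  -- the label role: at most `m₁ - 1`, thanks to the bichromatic label
  set c := I.vars j₁ 2 with hc
  have ht1 : 1 ≤ (E.filter fun j => I.vars j 2 = c ∧ y j = true).card :=
    Finset.card_pos.2 ⟨j₁, Finset.mem_filter.2 ⟨hj₁, rfl, hy₁⟩⟩
  have ht0 : 1 ≤ (E.filter fun j => I.vars j 2 = c ∧ y j = false).card :=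
    Finset.card_pos.2 ⟨j₂, Finset.mem_filter.2 ⟨hj₂, hlab.symm, hy₂⟩⟩
  have hT2 : ∑ j ∈ E, sg j * bx (I.vars j 2) ≤ m₁ - 1 := by
    rw [hT 2]
    have hpt : ∀ v ∈ (Finset.univ : Finset (Fin N)),
        bx v * (((E.filter fun j => I.vars j 2 = v ∧ y j = true).card : ℤ) -
          ((E.filter fun j => I.vars j 2 = v ∧ y j = false).card : ℤ)) ≤
        ((E.filter fun j => I.vars j 2 = v ∧ y j = true).card : ℤ) - (if v = c then 1 else 0) := by
      intro v _
      simp only [hbx]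
      by_cases hvc : v = c
      · subst hvc
        rw [if_pos rfl]
        split_ifs
        · omega
        · omega
      · rw [if_neg hvc]
        split_ifs
        · omega
        · omega
    refine (Finset.sum_le_sum hpt).trans ?_
    rw [Finset.sum_sub_distrib, sum_card_fiber I E y 2 true, Finset.sum_ite_eq' Finset.univ c,
      if_pos (Finset.mem_univ _)]
  -- contradiction
  rw [hS', hT0, hT1] at hlow
  linarith

end Summit.PneNP.PneNP.Theorems.Nc03Reduction
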